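import Summits.AtomisticToContinuum.Crystallization.Theorems.PerronTransitivityUniformBindingRigidityCohesionC

/-!
# Cohesion of uniformly bound Lennard-Jones configurations, IV: reduction to half-space configurations

Helper file (`--supports stmt-AtomisticToContinuum-15099`) of the stub `stub_cohesion` of the line
`registered` (skeleton `Cruxes/UniformBindingRigidity/Lines/birth.lean`) of the crux
`Summit.AtomisticToContinuum.Crystallization.Theses.PerronTransitivity.UniformBindingRigidity`
(item stmt-AtomisticToContinuum-15099), concluding parts I–III (`…CohesionA/B/C.lean`).

`cohesion_of_noHalfSpaceBinding` / `noHalfSpaceBinding_iff_cohesion`: the stub `stub_cohesion` (a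
non-empty uniformly discrete uniformly `2e*`-bound `X ⊆ ℝ³` is relatively dense) FOLLOWS FROM — and
is therefore EQUIVALENT to, the converse being trivial (`tu`, `t → ∞`, is far from a half-space
configuration) — the non-existence of uniformly bound half-space configurations:

  `(NHB)` for every `1/4`-separated `Y ⊆ ℝ³` with `0 ∈ Y` lying in a closed half-space
  `{q | ⟪q, u⟫ ≤ 0}` (`‖u‖ = 1`) some site of `Y` has Lennard-Jones site sum `> 2e*`.

Proof (compactness; §9): if `X` is not relatively dense it is `1/4`-separated (part I) and has
touching empty balls `B(yₙ, ρₙ)`, `ρₙ ≥ n + 1`, touching at `pₙ ∈ X` (part I); the translates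
`X − pₙ` contain `0`, are `1/4`-separated and uniformly `2e*`-bound (translation invariance of site
sums, `tsum_site_sub_const`), and miss the open balls of radius `ρₙ` centred at `ρₙ uₙ`,
`‖uₙ‖ = 1`.  By the sequential compactness of uniformly discrete sets in the local matching topology
(tree: `exists_subseq_forall_eventually_ballMatch`) and of the unit sphere, along a subsequence
`X − pₙ → Y` locally and `uₙ → u`; then `0 ∈ Y` (the points of `Y` near `0` form a finite set
approached by `0`), `Y` is `1/4`-separated, `Y ⊆ {⟪·, u⟫ ≤ 0}` (a point `q` with `⟪q, u⟫ = s > 0` is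
matched in `X − pₙ` by points `a` with `⟪a, uₙ⟩ ≥ s/2`, but `a ∉ B(ρₙuₙ, ρₙ)` forces
`‖a‖² ≥ 2ρₙ⟪a, uₙ⟫ ≥ ρₙ s → ∞`), and `Y` is uniformly `2e*`-bound (part III,
`tsum_site_le_of_forall_exists_ballMatch`) — contradicting `(NHB)`.

So the open core of the stub is exactly `(NHB)`: a sitewise form of positive surface tension of
Lennard-Jones matter at a flat free surface (Blanc–Lewin 2015, §2.3: open).  It is genuinely
MULTI-site: numerically (heuristic search, explicit feasible configurations) a `0.75`-separated
half-space configuration of `99` points has single-site sum `Σ V_LJ(|q|) ≈ −1.47 < 2e* ≈ −1.435`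
(`−1.40` found at separation `0.775`, `−1.32` at `0.8`, `−1.13` at `0.85`, `−1.66` at `0.7`), while no
local bootstrap can certify a separation above `≈ 0.75–0.8` at a uniformly bound site (part I certifies
`1/4`); so the binding of the NEIGHBOURS of the surface site must enter.  All `[folklore]`.
-/

noncomputable section

namespace Summit.AtomisticToContinuum.Crystallization.Theorems.PerronTransitivityUniformBindingRigidity

open scoped BigOperators Topology
open Filter Set Metric
open Literature.MathematicalPhysics.StatisticalMechanics
open Summit.AtomisticToContinuum.Crystallization.Theorems.ChargedEnergyGapNegative (E3)

/-! ## §9 Cohesion from the non-existence of uniformly bound half-space configurations -/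

/-- **Site sums are translation invariant**: the site sum of `X − v` at `p − v` is the site sum of
`X` at `p` (re-index by `q ↦ q − v`, `dist (p − v) (q − v) = dist p q`). [folklore] -/
theorem tsum_site_sub_const (X : Set E3) (v p : E3) :
    ∑' q : {q : E3 // q ∈ (fun z => z - v) '' X ∧ q ≠ p - v}, lennardJones (dist (p - v) q.1) =
      ∑' q : {q : E3 // q ∈ X ∧ q ≠ p}, lennardJones (dist p q.1) := by
  let e : {q : E3 // q ∈ X ∧ q ≠ p} ≃ {q : E3 // q ∈ (fun z => z - v) '' X ∧ q ≠ p - v} :=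
    { toFun := fun q => ⟨q.1 - v, ⟨q.1, q.2.1, rfl⟩, fun h => q.2.2 (sub_left_injective h)⟩
      invFun := fun q => ⟨q.1 + v, by
          obtain ⟨z, hz, hzq⟩ := q.2.1
          have : q.1 + v = z := by rw [← hzq, sub_add_cancel]
          rw [this]; exact hz,
        fun h => q.2.2 (eq_sub_of_add_eq h)⟩
      left_inv := fun q => Subtype.ext (sub_add_cancel q.1 v)
      right_inv := fun q => Subtype.ext (add_sub_cancel_right q.1 v) }
  rw [← Equiv.tsum_eq e]
  refine tsum_congr fun q => ?_
  show lennardJones (dist (p - v) (q.1 - v)) = lennardJones (dist p q.1)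
  rw [dist_sub_right]

/-- **Cohesion (`stub_cohesion`) from the non-existence of uniformly bound half-space
configurations.**  Hypothesis `(NHB)`: every `1/4`-separated `Y ⊆ ℝ³` containing `0` and lying in
a closed half-space `{q | ⟪q, u⟫ ≤ 0}` (`‖u‖ = 1`) has a site whose Lennard-Jones site sum exceeds
`2e*`.  Conclusion: the stub verbatim.  (Compactness: translates of `X` re-centred at the touching
points of huge empty balls converge locally, along a subsequence, to a uniformly bound half-space
configuration; see the module docstring.)  The converse implication is immediate (a uniformly bound
half-space configuration has arbitrarily large holes), so `(NHB)` is EQUIVALENT to the stub.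
[folklore] -/
theorem cohesion_of_noHalfSpaceBinding
    (H : ∀ (Y : Set (EuclideanSpace ℝ (Fin 3))) (u : EuclideanSpace ℝ (Fin 3)), ‖u‖ = 1 →
      (0 : EuclideanSpace ℝ (Fin 3)) ∈ Y →
      (∀ p ∈ Y, ∀ q ∈ Y, p ≠ q → 1 / 4 ≤ dist p q) →
      (∀ q ∈ Y, inner ℝ q u ≤ 0) →
      ∃ p ∈ Y, 2 * (⨅ Q : PeriodicConfiguration 3, Q.energyPerParticle lennardJones) <
        ∑' q : {q : EuclideanSpace ℝ (Fin 3) // q ∈ Y ∧ q ≠ p}, lennardJones (dist p q.1)) :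
    ∀ X : Set (EuclideanSpace ℝ (Fin 3)), X.Nonempty →
      (∃ δ : ℝ, 0 < δ ∧ ∀ p ∈ X, ∀ q ∈ X, p ≠ q → δ ≤ dist p q) →
      (∀ p ∈ X, ∑' q : {q : EuclideanSpace ℝ (Fin 3) // q ∈ X ∧ q ≠ p},
          lennardJones (dist p q.1) ≤
        2 * ⨅ Q : PeriodicConfiguration 3, Q.energyPerParticle lennardJones) →
      ∃ R : ℝ, ∀ y : EuclideanSpace ℝ (Fin 3), ∃ p ∈ X, dist y p ≤ R := by
  intro X hne hX hU
  by_contra hR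
  set B : ℝ := 2 * (⨅ Q : PeriodicConfiguration 3, Q.energyPerParticle lennardJones) with hB
  have h4 : (0 : ℝ) < 1 / 4 := by norm_num
  have hsep : ∀ a ∈ X, ∀ b ∈ X, a ≠ b → 1 / 4 ≤ dist a b :=
    quarter_le_dist hX fun p hp => (hU p hp).trans two_mul_iInf_lt_zero.le
  -- touching empty balls of radius `≥ n + 1`
  choose y p hp hyp hmin using fun n : ℕ => exists_touching h4 hsep hne hR ((n : ℝ) + 1)
  -- the translated configurations `X − p n`
  set Xs : ℕ → Set E3 := fun n => (fun z => z - p n) '' X with hXs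
  have hXsep : ∀ n, ∀ a ∈ Xs n, ∀ b ∈ Xs n, a ≠ b → 1 / 4 ≤ dist a b := by
    rintro n _ ⟨a, ha, rfl⟩ _ ⟨b, hb, rfl⟩ hab
    rw [dist_sub_right]
    exact hsep a ha b hb fun h => hab (by rw [h])
  have hX0 : ∀ n, (0 : E3) ∈ Xs n := fun n => ⟨p n, hp n, sub_self _⟩
  have hXbd : ∀ n, ∀ a ∈ Xs n,
      ∑' q : {q : E3 // q ∈ Xs n ∧ q ≠ a}, lennardJones (dist a q.1) ≤ B := by
    rintro n _ ⟨a, ha, rfl⟩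
    rw [tsum_site_sub_const X (p n) a]
    exact hU a ha
  -- the hole seen from `p n`: centre `c n`, radius `ρ n ≥ n + 1`, direction `u n`
  set c : ℕ → E3 := fun n => y n - p n with hc
  set ρ : ℕ → ℝ := fun n => dist (y n) (p n) with hρ
  have hρc : ∀ n, ‖c n‖ = ρ n := fun n => (dist_eq_norm (y n) (p n)).symm
  have hρn : ∀ n : ℕ, (n : ℝ) + 1 ≤ ρ n := hyp
  have hρ0 : ∀ n, 0 < ρ n := fun n => by
    have := hρn n
    have h0 : (0 : ℝ) ≤ n := Nat.cast_nonneg n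
    linarith
  have hempty : ∀ n, ∀ a ∈ Xs n, ρ n ≤ dist (c n) a := by
    rintro n _ ⟨a, ha, rfl⟩
    show dist (y n) (p n) ≤ dist (y n - p n) (a - p n)
    rw [dist_sub_right]
    exact hmin n a ha
  set u : ℕ → E3 := fun n => (ρ n)⁻¹ • c n with hu
  have hu1 : ∀ n, ‖u n‖ = 1 := fun n => by
    show ‖(ρ n)⁻¹ • c n‖ = 1
    rw [norm_smul, norm_inv, Real.norm_eq_abs, abs_of_pos (hρ0 n), hρc,
      inv_mul_cancel₀ (hρ0 n).ne']
  have hcu : ∀ n, c n = ρ n • u n := fun n => by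
    show c n = ρ n • ((ρ n)⁻¹ • c n)
    rw [smul_smul, mul_inv_cancel₀ (hρ0 n).ne', one_smul]
  -- local limit of the translated configurations, and a limit direction
  obtain ⟨φ, Y, hφ, hYsep, hlim⟩ := exists_subseq_forall_eventually_ballMatch h4 Xs hXsep
  obtain ⟨w, hw, ψ, hψ, hlimu⟩ := (isCompact_sphere (0 : E3) 1).tendsto_subseq
    (x := fun n => u (φ n)) fun n => mem_sphere_zero_iff_norm.2 (hu1 (φ n))
  have hw1 : ‖w‖ = 1 := mem_sphere_zero_iff_norm.1 hw
  have hlim' : ∀ R ε : ℝ, 0 < ε → ∀ᶠ j in atTop, BallMatch ε R 0 (Xs (φ (ψ j))) Y :=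
    fun R ε hε => hψ.tendsto_atTop.eventually (hlim R ε hε)
  have hge : ∀ j : ℕ, (j : ℝ) + 1 ≤ ρ (φ (ψ j)) := fun j => by
    have h1 : (j : ℝ) ≤ (φ (ψ j) : ℕ) := by exact_mod_cast (hψ.le_apply.trans hφ.le_apply)
    linarith [hρn (φ (ψ j))]
  -- (1) `0 ∈ Y`
  have hY0 : (0 : E3) ∈ Y := by
    by_contra h0
    have hfin := finite_sep_ball h4 hYsep (0 : E3) 1
    obtain ⟨η, hη, hη1, hηY⟩ : ∃ η : ℝ, 0 < η ∧ η ≤ 1 ∧ ∀ q ∈ Y, dist q 0 ≤ 1 → η ≤ dist q 0 := by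
      by_cases hemp : hfin.toFinset.Nonempty
      · obtain ⟨q₀, hq₀, hminq⟩ := hfin.toFinset.exists_min_image (fun q => dist q 0) hemp
        rw [Set.Finite.mem_toFinset] at hq₀
        have hq₀0 : 0 < dist q₀ 0 := dist_pos.2 fun h => h0 (h ▸ hq₀.1)
        refine ⟨dist q₀ 0, hq₀0, hq₀.2, fun q hq hq1 => hminq q ?_⟩
        rw [Set.Finite.mem_toFinset]; exact ⟨hq, hq1⟩
      · refine ⟨1, one_pos, le_rfl, fun q hq hq1 => ?_⟩
        exact absurd ⟨q, by rw [Set.Finite.mem_toFinset]; exact ⟨hq, hq1⟩⟩ hemp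
    obtain ⟨j, hj⟩ := (hlim' 1 (η / 2) (by positivity)).exists
    obtain ⟨s, hs, hs0⟩ := hj.2 0 (hX0 _) (by simp)
    rw [dist_comm] at hs0
    have hs1 : dist s 0 ≤ 1 := by linarith
    have := hηY s hs hs1
    linarith
  -- (2) `Y` lies in the closed half-space `⟪·, w⟫ ≤ 0`
  have hYhalf : ∀ q ∈ Y, inner ℝ q w ≤ 0 := by
    intro q hq
    by_contra hpos
    rw [not_le] at hpos
    set sq : ℝ := inner ℝ q w with hsq
    -- tolerances
    set ε : ℝ := min (sq / 4) (1 / 2) with hε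
    have hε0 : 0 < ε := by positivity
    have hεs : ε ≤ sq / 4 := min_le_left _ _
    have hε1 : ε ≤ 1 / 2 := min_le_right _ _
    set ε' : ℝ := sq / (4 * (‖q‖ + 1)) with hε'
    have hq1 : 0 < ‖q‖ + 1 := by positivity
    have hε'0 : 0 < ε' := by positivity
    have hε'q : ε' * ‖q‖ ≤ sq / 4 := by
      rw [hε', div_mul_eq_mul_div, div_le_div_iff₀ (by positivity) (by norm_num)]
      nlinarith [norm_nonneg q]
    -- eventually: matched, direction close, radius large
    have h1 := hlim' ‖q‖ ε hε0
    have h2 : ∀ᶠ j in atTop, dist (u (φ (ψ j))) w < ε' := Metric.tendsto_nhds.1 hlimu ε' hε'0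
    have h3 : ∀ᶠ j : ℕ in atTop, (‖q‖ + 1) ^ 2 / sq < (j : ℝ) + 1 := by
      obtain ⟨N, hN⟩ := exists_nat_gt ((‖q‖ + 1) ^ 2 / sq)
      filter_upwards [eventually_ge_atTop N] with j hj
      have : (N : ℝ) ≤ j := by exact_mod_cast hj
      linarith
    obtain ⟨j, ⟨hBM, hdir⟩, hbig⟩ := ((h1.and h2).and h3).exists
    set n : ℕ := φ (ψ j) with hn
    -- the partner `a` of `q`
    obtain ⟨a, ha, haq⟩ := hBM.1 q hq (by rw [dist_zero_right])
    -- `⟪u n, a⟫ ≥ sq / 2`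
    have hinner : sq / 2 ≤ inner ℝ (u n) a := by
      have e1 : inner ℝ (u n) a = inner ℝ w q + inner ℝ (u n - w) q + inner ℝ (u n) (a - q) := by
        rw [inner_sub_left, inner_sub_right]; ring
      have b1 : |inner ℝ (u n - w) q| ≤ ε' * ‖q‖ := by
        refine (abs_real_inner_le_norm _ _).trans ?_
        have : ‖u n - w‖ ≤ ε' := by rw [← dist_eq_norm]; exact hdir.le
        exact mul_le_mul_of_nonneg_right this (norm_nonneg _)
      have b2 : |inner ℝ (u n) (a - q)| ≤ ε := by
        refine (abs_real_inner_le_norm _ _).trans ?_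
        rw [hu1, one_mul, ← dist_eq_norm]
        exact haq
      have hwq : inner ℝ w q = sq := by rw [hsq, real_inner_comm]
      rw [e1, hwq]
      have := neg_abs_le (inner ℝ (u n - w) q)
      have := neg_abs_le (inner ℝ (u n) (a - q))
      linarith
    -- the empty ball: `‖a‖² ≥ 2 ρ ⟪u n, a⟫`
    have hball : 2 * ρ n * inner ℝ (u n) a ≤ ‖a‖ ^ 2 := by
      have hd := hempty n a ha
      rw [hcu n, dist_eq_norm] at hd
      have hsq' : (ρ n) ^ 2 ≤ ‖ρ n • u n - a‖ ^ 2 := pow_le_pow_left₀ (hρ0 n).le hd 2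
      rw [norm_sub_sq_real, norm_smul, Real.norm_eq_abs, abs_of_pos (hρ0 n), hu1, mul_one,
        real_inner_smul_left] at hsq'
      linarith
    -- `‖a‖ ≤ ‖q‖ + 1`
    have ha1 : ‖a‖ ≤ ‖q‖ + 1 := by
      have : ‖a‖ ≤ ‖q‖ + dist a q := by
        rw [dist_eq_norm]; linarith [norm_sub_norm_le a q]
      linarith
    have ha2 : ‖a‖ ^ 2 ≤ (‖q‖ + 1) ^ 2 := pow_le_pow_left₀ (norm_nonneg _) ha1 2
    -- `ρ n · sq ≤ (‖q‖ + 1)²`, against `ρ n ≥ j + 1 > (‖q‖ + 1)² / sq`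
    have hρs : ρ n * sq ≤ (‖q‖ + 1) ^ 2 := by nlinarith [hρ0 n]
    have hlt : (‖q‖ + 1) ^ 2 < ρ n * sq := by
      rw [div_lt_iff₀ hpos] at hbig
      nlinarith [hge j]
    linarith
  -- (3) `Y` is uniformly `2e*`-bound
  have hYbd : ∀ q ∈ Y, ∑' z : {z : E3 // z ∈ Y ∧ z ≠ q}, lennardJones (dist q z.1) ≤ B := by
    intro q hq
    refine tsum_site_le_of_forall_exists_ballMatch h4 hYsep (fun R ε hε => ?_) hq
    obtain ⟨j, hj⟩ := (hlim' R ε hε).exists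
    exact ⟨Xs (φ (ψ j)), hXsep _, hXbd _, hj⟩
  -- contradiction with `(NHB)`
  obtain ⟨q, hq, hlt⟩ := H Y w hw1 hY0 hYsep hYhalf
  exact absurd (hYbd q hq) (not_le.2 hlt)

/-- **The stub is EQUIVALENT to the non-existence of uniformly bound half-space configurations.**
`(NHB) ↔ stub_cohesion`: `→` is `cohesion_of_noHalfSpaceBinding`; `←` because a uniformly bound
half-space configuration `Y ∋ 0`, `Y ⊆ {⟪·, u⟫ ≤ 0}`, would be a non-empty uniformly discrete
uniformly bound set with the points `t u`, `t → ∞`, arbitrarily far from it. [folklore] -/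
theorem noHalfSpaceBinding_iff_cohesion :
    (∀ (Y : Set (EuclideanSpace ℝ (Fin 3))) (u : EuclideanSpace ℝ (Fin 3)), ‖u‖ = 1 →
      (0 : EuclideanSpace ℝ (Fin 3)) ∈ Y →
      (∀ p ∈ Y, ∀ q ∈ Y, p ≠ q → 1 / 4 ≤ dist p q) →
      (∀ q ∈ Y, inner ℝ q u ≤ 0) →
      ∃ p ∈ Y, 2 * (⨅ Q : PeriodicConfiguration 3, Q.energyPerParticle lennardJones) <
        ∑' q : {q : EuclideanSpace ℝ (Fin 3) // q ∈ Y ∧ q ≠ p}, lennardJones (dist p q.1)) ↔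
    ∀ X : Set (EuclideanSpace ℝ (Fin 3)), X.Nonempty →
      (∃ δ : ℝ, 0 < δ ∧ ∀ p ∈ X, ∀ q ∈ X, p ≠ q → δ ≤ dist p q) →
      (∀ p ∈ X, ∑' q : {q : EuclideanSpace ℝ (Fin 3) // q ∈ X ∧ q ≠ p},
          lennardJones (dist p q.1) ≤
        2 * ⨅ Q : PeriodicConfiguration 3, Q.energyPerParticle lennardJones) →
      ∃ R : ℝ, ∀ y : EuclideanSpace ℝ (Fin 3), ∃ p ∈ X, dist y p ≤ R := by
  refine ⟨cohesion_of_noHalfSpaceBinding, fun hC Y u hu h0 hsep hhalf => ?_⟩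
  by_contra hall
  push Not at hall
  obtain ⟨R, hR⟩ := hC Y ⟨0, h0⟩ ⟨1 / 4, by norm_num, hsep⟩ hall
  obtain ⟨p, hp, hd⟩ := hR ((|R| + 1) • u)
  have hpu : inner ℝ p u ≤ 0 := hhalf p hp
  have huu : inner ℝ u u = 1 := by rw [real_inner_self_eq_norm_sq, hu]; norm_num
  have h1 : inner ℝ ((|R| + 1) • u - p) u = (|R| + 1) - inner ℝ p u := by
    rw [inner_sub_left, real_inner_smul_left, huu, mul_one]
  have h2 : inner ℝ ((|R| + 1) • u - p) u ≤ ‖(|R| + 1) • u - p‖ := by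
    have := real_inner_le_norm ((|R| + 1) • u - p) u
    rwa [hu, mul_one] at this
  rw [dist_eq_norm] at hd
  have hR' : R ≤ |R| := le_abs_self R
  linarith

/-! ## Registered sub-goal of `stub_cohesion`: the half-space reduction -/

/-- **Sub-goal `stub_cohesion_of_noHalfSpaceBinding` of the stub `stub_cohesion`** (registered on
stmt-AtomisticToContinuum-15099): the non-existence of uniformly `2e*`-bound `1/4`-separated
half-space configurations through `0` implies the stub `stub_cohesion` verbatim
(`cohesion_of_noHalfSpaceBinding` in arrow form; the converse is immediate, so the antecedent is
EQUIVALENT to the stub and is its open core). [folklore] -/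
theorem stub_cohesion_of_noHalfSpaceBinding :
    (∀ (Y : Set (EuclideanSpace ℝ (Fin 3))) (u : EuclideanSpace ℝ (Fin 3)), ‖u‖ = 1 →
      (0 : EuclideanSpace ℝ (Fin 3)) ∈ Y →
      (∀ p ∈ Y, ∀ q ∈ Y, p ≠ q → 1 / 4 ≤ dist p q) →
      (∀ q ∈ Y, inner ℝ q u ≤ 0) →
      ∃ p ∈ Y, 2 * (⨅ Q : PeriodicConfiguration 3, Q.energyPerParticle lennardJones) <
        ∑' q : {q : EuclideanSpace ℝ (Fin 3) // q ∈ Y ∧ q ≠ p}, lennardJones (dist p q.1)) →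
    ∀ X : Set (EuclideanSpace ℝ (Fin 3)), X.Nonempty →
      (∃ δ : ℝ, 0 < δ ∧ ∀ p ∈ X, ∀ q ∈ X, p ≠ q → δ ≤ dist p q) →
      (∀ p ∈ X, ∑' q : {q : EuclideanSpace ℝ (Fin 3) // q ∈ X ∧ q ≠ p},
          lennardJones (dist p q.1) ≤
        2 * ⨅ Q : PeriodicConfiguration 3, Q.energyPerParticle lennardJones) →
      ∃ R : ℝ, ∀ y : EuclideanSpace ℝ (Fin 3), ∃ p ∈ X, dist y p ≤ R :=
  fun H => cohesion_of_noHalfSpaceBinding H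

end Summit.AtomisticToContinuum.Crystallization.Theorems.PerronTransitivityUniformBindingRigidity

end
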